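import Summits.AtomisticToContinuum.HydrodynamicLimit.Theorems.CollisionIsometryCLTDiffuseBackwardInfluenceConditionalPair
import HarnessLib

/-!
# `DiffuseBackwardInfluence` (stmt-AtomisticToContinuum-12950), line `share-nondegeneracy-one-flight`: PROMOTION KIT
(continuation lead c7; `--supports` file; registered sub-goals `nearSetLDSmall_promoted_iff`, `remergeBounded_promoted_iff`,
`delayedRemergeRare_promoted_iff`)

Purpose. The line is closed MODULO three conjecture-level inputs, each typed in `Theorems/` with a landed consumer
(`diffuseBackwardInfluence_of_nearSetLD_of_remergeBounded_of_delayedRemergeRare`, …ConditionalPairFinal):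
the lever `ShareLD.NearSetLD` (…OneFlightShareLD), `PairPath.RemergeBounded` (…PairDefs), `DelayedRemergeRare` (…PairDelayedDefs).
Leads c4/c5/c6 and strategist s1 (`Cruxes/DiffuseBackwardInfluence/STRATEGY-CENSUS.md` D4) ask the planner to PROMOTE them to route items;
the typing obstacle recorded there is that a route item lives in the Theses file, which cannot import `Theorems/*` (the vocabulary
`blockMass/shareFrac/hopKernel/apartFrom/slotStart/nearScore/…` is Theorems-side; Theses → Theorems → Theses would be an import cycle).

This file removes the obstacle WITHOUT moving any vocabulary: for each input it gives a SELF-CONTAINED statement over Literature/Mathlib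
vocabulary only (the crux's own `let`-telescope style: `pre/pairs/stepF/colls/MN` are the crux's `let M` pieces, then block columns/masses/
shares, the realised unit normal, handed-over fractions, the hop kernel, the slot grid, the no-inflow pair transport through `Nat.rec`, the
directional score with its decidability instances spelled out) and PROVES it equivalent to the Theorems-side statement — by `Iff.rfl` for the
lever and for `RemergeBounded` (definitional unfolding, exactly as `DiffuseBackwardInfluenceNeg.dbi_iff` reads the crux back), and for
`DelayedRemergeRare` by `Iff.rfl` up to the one non-definitional step `apartRec = apartFrom` (the tree's `apartFrom` is compiled by structural
recursion; the self-contained text uses the recursor; equality by induction, `apartRec_eq`). The three texts were also checked to elaborate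
verbatim in the exact context of `Theses/CollisionIsometryCLT.lean` (its imports, namespace and `open`s).

How the planner uses it (D4): file three crux items whose signatures are, character for character, the left-hand sides below (suggested decl
names `NearSetLDSmall`, `TracerRemergeBounded`, `TracerDelayedRemergeRare`); the glue `DiffuseBackwardInfluence ⇐ the three items` is then
`diffuseBackwardInfluence_of_nearSetLD_of_remergeBounded_of_delayedRemergeRare` composed with the three `…_promoted_iff.1` (one line each; the
route-side decls unfold to the texts by `Iff.rfl`). Nothing here is asserted: two transport functionals re-expressed through `Nat.rec`, their
equality with the tree's, and three equivalences.
-/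

namespace Summit.AtomisticToContinuum.HydrodynamicLimit.Theorems.DiffuseBackwardInfluenceShare

open scoped BigOperators Topology ENNReal InnerProductSpace Classical
open Filter Set MeasureTheory
open Summit.AtomisticToContinuum.HydrodynamicLimit.Theorems.DiffuseBackwardInfluenceNeg

noncomputable section

namespace Promotion

/-! ## §1 The no-inflow pair transport through the recursor -/

variable (σ : ℝ) (N : ℕ) in
/-- `apartFrom` (pairs of tracers of `src` apart since the start of slot `r`, no inflow; …PairDefs §1) written through `Nat.rec` instead of
structural recursion — the form a self-contained route-item signature can spell. [folklore] -/
def apartRec (y : Cfg N) (src : Fin (N + 1)) (Δ : ℝ) (S r t : ℕ) : Fin (N + 1) → Fin (N + 1) → ℝ :=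
  @Nat.rec (fun _ => Fin (N + 1) → Fin (N + 1) → ℝ)
    (fun i j => if i = j then 0 else
      blockMass σ N y (slotStart σ N y Δ S r) i src / 3 * (blockMass σ N y (slotStart σ N y Δ S r) j src / 3))
    (fun t ih => fun i j => if i = j then 0 else
      ∑ i' : Fin (N + 1), ∑ j' : Fin (N + 1), ih i' j' *
        (hopKernel σ N y src (slotStart σ N y Δ S r + t) i' i * hopKernel σ N y src (slotStart σ N y Δ S r + t) j' j))
    t

/-- `apartRec = apartFrom` pointwise (induction on the step count; both recursions have the same base and step). [folklore] -/
theorem apartRec_eq (σ : ℝ) (N : ℕ) (y : Cfg N) (src : Fin (N + 1)) (Δ : ℝ) (S r t : ℕ) :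
    apartRec σ N y src Δ S r t = apartFrom σ N y src Δ S r t := by
  induction t with
  | zero => rfl
  | succ t ih =>
    funext i j
    show (if i = j then 0 else ∑ i' : Fin (N + 1), ∑ j' : Fin (N + 1), apartRec σ N y src Δ S r t i' j' *
        (hopKernel σ N y src (slotStart σ N y Δ S r + t) i' i * hopKernel σ N y src (slotStart σ N y Δ S r + t) j' j)) = _
    rw [ih]
    rfl

/-- `apartRec = apartFrom` as functions of all their arguments. [folklore] -/
theorem apartRec_eq_apartFrom : @apartRec = @apartFrom := by
  funext σ N y src Δ S r t
  exact apartRec_eq σ N y src Δ S r t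

variable (σ : ℝ) (N : ℕ) in
/-- `delayedRemAt` (…PairDelayedDefs §1) over `apartRec`, with its two `let`s substituted. [folklore] -/
def delayedRemAtRec (y : Cfg N) (src : Fin (N + 1)) (Δ : ℝ) (S r t : ℕ) : ℝ :=
  ∑ i : Fin (N + 1), ∑ i' : Fin (N + 1), ∑ j' : Fin (N + 1),
    apartRec σ N y src Δ S (r - 1) (slotStart σ N y Δ S r - slotStart σ N y Δ S (r - 1) + t) i' j' *
      (hopKernel σ N y src (slotStart σ N y Δ S (r - 1) + (slotStart σ N y Δ S r - slotStart σ N y Δ S (r - 1) + t)) i' i *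
        hopKernel σ N y src (slotStart σ N y Δ S (r - 1) + (slotStart σ N y Δ S r - slotStart σ N y Δ S (r - 1) + t)) j' i)

/-- `delayedRemAtRec = delayedRemAt`. [folklore] -/
theorem delayedRemAtRec_eq : @delayedRemAtRec = @delayedRemAt := by
  funext σ N y src Δ S r t
  unfold delayedRemAtRec delayedRemAt
  rw [apartRec_eq_apartFrom]

variable (σ : ℝ) (N : ℕ) in
/-- `delayedRemFr` (…PairDelayedDefs §1) over `apartRec`. [folklore] -/
def delayedRemFrRec (y : Cfg N) (Δ : ℝ) (S : ℕ) : ℝ :=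
  ((N + 1 : ℕ) : ℝ)⁻¹ * ∑ src : Fin (N + 1), ∑ r ∈ Finset.Ico 1 S,
    ∑ t ∈ Finset.range (slotStart σ N y Δ S (r + 1) - slotStart σ N y Δ S r), delayedRemAtRec σ N y src Δ S r t

/-- `delayedRemFrRec = delayedRemFr`. [folklore] -/
theorem delayedRemFrRec_eq : @delayedRemFrRec = @delayedRemFr := by
  funext σ N y Δ S
  unfold delayedRemFrRec delayedRemFr
  rw [delayedRemAtRec_eq]

/-! ## §2 The three self-contained statements and their read-backs -/

/-- **THE LEVER, SELF-CONTAINED** (registered sub-goal `nearSetLDSmall_promoted_iff`): the left-hand side — a `Prop` over Literature/Mathlib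
vocabulary only, elaborating verbatim in `Theses/CollisionIsometryCLT.lean` — is DEFINITIONALLY the stub `stub_nearSetLD`'s statement
`∃ σ₀ > 0, ∀ σ ∈ (0, σ₀), ∀ θ > 0, ShareLD.NearSetLD σ θ` (read-back by `Iff.rfl`; the `let`s `G/V/X/ε` abbreviate the torus geometry, `ℝ³`, the phase space and `hsDiameter σ`, `D` the classical decidability of
`(pairs N y k).Nonempty`, and `pre/pairs/stepF/colls/MN/bc/bm/nrm/un/sls/tch/hci/nd/nsc/eqL` are `pre/pairsAt/step/colls/transferN/blockCol/
blockMass/normalAt/unitNormal/slotStart/Touches/HasCollIn/ShareLD.nearDir/ShareLD.nearScore/eqLaw`, the decidability instances of `nearScore` spelled out as elaborated in the tree). [folklore] -/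
theorem nearSetLDSmall_promoted_iff : (∃ σ₀ : ℝ, 0 < σ₀ ∧ ∀ σ : ℝ, 0 < σ → σ < σ₀ → let G := Literature.Analysis.FluidPDE.Torus.geometry (Fin 3); let V := EuclideanSpace ℝ (Fin 3); let X := fun (N : ℕ) => Literature.Analysis.FluidPDE.Config (N + 1) (Fin 3) (UnitAddTorus (Fin 3)); let ε := fun (N : ℕ) => Literature.MathematicalPhysics.KineticTheory.hsDiameter σ N; let pre := fun (N : ℕ) (y : X N) (k : ℕ) => let z := Literature.Analysis.FluidPDE.Alexander.stateAfter G (ε N) y k; Literature.Analysis.FluidPDE.freeFlight G (Literature.Analysis.FluidPDE.Alexander.freeExitTime G (ε N) z).toReal z; let pairs := fun (N : ℕ) (y : X N) (k : ℕ) => Literature.Analysis.FluidPDE.Alexander.incomingPairs G (ε N) (pre N y k); let D := fun (N : ℕ) (y : X N) (k : ℕ) => Classical.propDecidable (pairs N y k).Nonempty; let stepF := fun (N : ℕ) (y : X N) (W' : Fin (N + 1) → V) (k : ℕ) => @dite (Fin (N + 1) → V) (pairs N y k).Nonempty (D N y k) (fun h => fun i => (Literature.Analysis.FluidPDE.collidePair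 G h.some.1 h.some.2 (fun j => ((pre N y k j).1, W' j)) i).2) (fun _ => W'); let colls := fun (N : ℕ) (y : X N) (Δ : ℝ) => Literature.Analysis.FluidPDE.Alexander.collisionCount G (ε N) y Δ; let MN := fun (N : ℕ) (y : X N) (n : ℕ) (W : Fin (N + 1) → V) => (List.range n).foldl (stepF N y) W; let bc := fun (N : ℕ) (y : X N) (n : ℕ) (i k : Fin (N + 1)) (a : Fin 3) => MN N y n (Pi.single k (EuclideanSpace.single a (1 : ℝ))) i; let bm := fun (N : ℕ) (y : X N) (n : ℕ) (i k : Fin (N + 1)) => ∑ a : Fin 3, ‖bc N y n i k a‖ ^ 2; let nrm := fun (N : ℕ) (y : X N) (k : ℕ) => @dite V (pairs N y k).Nonempty (D N y k) (fun h => G.sepVec (pre N y k h.some.1).1 (pre N y k h.some.2).1) (fun _ => 0); let un := fun (N : ℕ) (y : X N) (k : ℕ) => ‖nrm N y k‖⁻¹ • nrm N y k; let sls := fun (N : ℕ) (y : X N) (Δ : ℝ) (S r : ℕ) => colls N y ((r : ℝ) * Δ / (S : ℝ)); let tch := fun (N : ℕ) (y : X N) (k : ℕ) (i : Fin (N + 1))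 => ∃ h : (pairs N y k).Nonempty, h.some.1 = i ∨ h.some.2 = i; let hci := fun (N : ℕ) (y : X N) (Δ : ℝ) (S r : ℕ) (i : Fin (N + 1)) => ∃ k, sls N y Δ S r ≤ k ∧ k < sls N y Δ S (r + 1) ∧ tch N y k i; let nd := fun (α : ℝ) (u : Fin 3 → V) => {ω : V | ∃ a : Fin 3, (∀ b, ‖u b‖ ≤ ‖u a‖) ∧ (inner ℝ ω (‖u a‖⁻¹ • u a) ^ 2 < α ^ 2 ∨ 1 - α ^ 2 < inner ℝ ω (‖u a‖⁻¹ • u a) ^ 2)}; let nsc := fun (N : ℕ) (y : X N) (Δ : ℝ) (S r : ℕ) (α : ℝ) (i : Fin (N + 1)) => @dite ℝ (hci N y Δ S r i) (Classical.propDecidable _) (fun h => let n : ℕ := @Nat.find (fun k => sls N y Δ S r ≤ k ∧ k < sls N y Δ S (r + 1) ∧ tch N y k i) (fun _ => @instDecidableAnd _ _ inferInstance (@instDecidableAnd _ _ inferInstance (Classical.propDecidable _))) h; ∑ k : Fin (N + 1), bm N y n i k / 3 * @ite ℝ (un N y n ∈ nd α (bc N y n i k)) (Classical.propDecidable _) (1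 : ℝ) 0) (fun _ => 0); let eqL := fun (θ : ℝ) (N : ℕ) (Φ : Literature.Analysis.FluidPDE.HardSphereFlow G (ε N) (N + 1)) => Literature.MathematicalPhysics.KineticTheory.localGibbsLaw σ (fun _ => 1) (fun _ => 0) (fun _ => θ) N Φ; ∀ θ : ℝ, 0 < θ → ∃ K : ℝ, 0 < K ∧ ∀ δ α : ℝ, 0 < δ → 0 < α → α < 1 → ∀ Δ : ℕ → ℝ, (∀ N, 0 < Δ N) → Tendsto Δ atTop (𝓝 0) → Tendsto (fun N : ℕ => Δ N * ((N + 1 : ℕ) : ℝ) ^ ((1 : ℝ) / 3)) atTop atTop → ∀ S r : ℕ, 1 ≤ S → r < S → ∀ᶠ N : ℕ in atTop, ∀ (Φ : Literature.Analysis.FluidPDE.HardSphereFlow G (ε N) (N + 1)) (A : Finset (Fin (N + 1))), δ * ((N : ℝ) + 1) ≤ (A.card : ℝ) → eqL θ N Φ {y : X N | ∀ i ∈ A, δ ≤ nsc N y (Δ N) S r α i} ≤ ENNReal.ofReal ((K * α / δ) ^ ((A.card : ℝ) / 2))) ↔ (∃ σ₀ : ℝ, 0 < σ₀ ∧ ∀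 σ : ℝ, 0 < σ → σ < σ₀ → ∀ θ : ℝ, 0 < θ → ShareLD.NearSetLD σ θ) :=
  Iff.rfl

/-- **RE-MERGES BOUNDED IN MEAN, SELF-CONTAINED** (registered sub-goal `remergeBounded_promoted_iff`): the left-hand side — over
Literature/Mathlib vocabulary only, elaborating verbatim in the Theses file — is DEFINITIONALLY `PairPath.RemergeBounded` (read-back by
`Iff.rfl`; extra `let`s `bs/sf/mAt/tRF` = `blockShare/shareFrac/mergeAt/totalRemFr`). [folklore] -/
theorem remergeBounded_promoted_iff : (∀ (a₀ θ₀ : UnitAddTorus (Fin 3) → ℝ) (u₀ : UnitAddTorus (Fin 3) → EuclideanSpace ℝ (Fin 3)), Continuous a₀ → Continuous θ₀ → Continuous u₀ → (∀ x, 0 < a₀ x) → (∀ x, 0 < θ₀ x) → ∃ σ₀ : ℝ, 0 < σ₀ ∧ ∀ σ : ℝ, 0 < σ → σ < σ₀ → let G := Literature.Analysis.FluidPDE.Torus.geometry (Fin 3); let V := EuclideanSpace ℝ (Fin 3); let X := fun (N : ℕ) => Literature.Analysis.FluidPDE.Config (N + 1) (Fin 3) (UnitAddTorus (Fin 3)); let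 ε := fun (N : ℕ) => Literature.MathematicalPhysics.KineticTheory.hsDiameter σ N; let pre := fun (N : ℕ) (y : X N) (k : ℕ) => let z := Literature.Analysis.FluidPDE.Alexander.stateAfter G (ε N) y k; Literature.Analysis.FluidPDE.freeFlight G (Literature.Analysis.FluidPDE.Alexander.freeExitTime G (ε N) z).toReal z; let pairs := fun (N : ℕ) (y : X N) (k : ℕ) => Literature.Analysis.FluidPDE.Alexander.incomingPairs G (ε N) (pre N y k); let D := fun (N : ℕ) (y : X N) (k : ℕ) => Classical.propDecidable (pairs N y k).Nonempty; let stepF := fun (N : ℕ) (y : X N) (W' : Fin (N + 1) → V) (k : ℕ) => @dite (Fin (N + 1) → V) (pairs N y k).Nonempty (D N y k) (fun h => fun i => (Literature.Analysis.FluidPDE.collidePair G h.some.1 h.some.2 (fun j => ((pre N y k j).1, W' j)) i).2) (fun _ => W'); let colls := fun (N : ℕ) (y : X N) (Δ : ℝ) => Literature.Analysis.FluidPDE.Alexander.collisionCount G (ε N) y Δ; let MN := fun (N : ℕ) (y : X N) (n : ℕ) (W : Fin (N + 1) → V) => (List.range n).foldl (stepF N y) W; let bc := fun (N : ℕ) (y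 : X N) (n : ℕ) (i k : Fin (N + 1)) (a : Fin 3) => MN N y n (Pi.single k (EuclideanSpace.single a (1 : ℝ))) i; let bm := fun (N : ℕ) (y : X N) (n : ℕ) (i k : Fin (N + 1)) => ∑ a : Fin 3, ‖bc N y n i k a‖ ^ 2; let nrm := fun (N : ℕ) (y : X N) (k : ℕ) => @dite V (pairs N y k).Nonempty (D N y k) (fun h => G.sepVec (pre N y k h.some.1).1 (pre N y k h.some.2).1) (fun _ => 0); let un := fun (N : ℕ) (y : X N) (k : ℕ) => ‖nrm N y k‖⁻¹ • nrm N y k; let bs := fun (N : ℕ) (y : X N) (n : ℕ) (i k : Fin (N + 1)) (ω : V) => ∑ a : Fin 3, inner ℝ ω (bc N y n i k a) ^ 2; let sf := fun (N : ℕ) (y : X N) (n : ℕ) (i k : Fin (N + 1)) (ω : V) => bs N y n i k ω / bm N y n i k; let mAt := fun (N : ℕ) (y : X N) (src : Fin (N + 1)) (k : ℕ) => @dite ℝ (pairs N y k).Nonempty (D N y k) (fun h => 2 * (bm N y k h.some.1 src / 3) * (bm N y k h.some.2 src / 3) * (sf N y k h.some.1 src (un N y k) * (1 - sf N y k h.some.2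 src (un N y k)) + sf N y k h.some.2 src (un N y k) * (1 - sf N y k h.some.1 src (un N y k)))) (fun _ => 0); let tRF := fun (N : ℕ) (y : X N) (Δ : ℝ) => ((N + 1 : ℕ) : ℝ)⁻¹ * ∑ src : Fin (N + 1), ∑ c ∈ Finset.range (colls N y Δ), mAt N y src c; ∀ Φ : (N : ℕ) → Literature.Analysis.FluidPDE.HardSphereFlow G (ε N) (N + 1), ∀ Δ : ℕ → ℝ, (∀ N, 0 < Δ N) → Tendsto Δ atTop (𝓝 0) → Tendsto (fun N : ℕ => Δ N * ((N + 1 : ℕ) : ℝ) ^ ((1 : ℝ) / 3)) atTop atTop → ∀ t : ℝ, 0 < t → ∃ M : ℝ, 0 ≤ M ∧ ∀ᶠ N : ℕ in atTop, ∫⁻ z, ENNReal.ofReal (tRF N ((Φ N).flow (t - Δ N) z) (Δ N)) ∂(Literature.MathematicalPhysics.KineticTheory.localGibbsLaw σ a₀ u₀ θ₀ N (Φ N)) ≤ ENNReal.ofReal M) ↔ PairPath.RemergeBounded :=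
  Iff.rfl

/-- **DELAYED RE-MERGES RARE, SELF-CONTAINED** (registered sub-goal `delayedRemergeRare_promoted_iff`): the left-hand side — over
Literature/Mathlib vocabulary only, elaborating verbatim in the Theses file — is EQUIVALENT to `DelayedRemergeRare`: definitionally up to
the no-inflow transport, which the text spells through `Nat.rec` (`apart` = `apartRec`) while the tree's `apartFrom` is compiled by
structural recursion; the two agree by `delayedRemFrRec_eq` (extra `let`s `hop/apart/dAt/dFr` = `hopKernel/apartRec/delayedRemAtRec/
delayedRemFrRec`). [folklore] -/
theorem delayedRemergeRare_promoted_iff : (∀ (a₀ θ₀ : UnitAddTorus (Fin 3) → ℝ) (u₀ : UnitAddTorus (Fin 3) → EuclideanSpace ℝ (Fin 3)), Continuous a₀ → Continuous θ₀ → Continuous u₀ → (∀ x, 0 < a₀ x) → (∀ x, 0 < θ₀ x) → ∃ σ₀ : ℝ, 0 < σ₀ ∧ ∀ σ : ℝ, 0 < σ → σ < σ₀ → let G := Literature.Analysis.FluidPDE.Torus.geometry (Fin 3); let V := EuclideanSpace ℝ (Fin 3); let X := fun (N : ℕ) => Literature.Analysis.FluidPDE.Config (N + 1) (Fin 3) (UnitAddTorus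 (Fin 3)); let ε := fun (N : ℕ) => Literature.MathematicalPhysics.KineticTheory.hsDiameter σ N; let pre := fun (N : ℕ) (y : X N) (k : ℕ) => let z := Literature.Analysis.FluidPDE.Alexander.stateAfter G (ε N) y k; Literature.Analysis.FluidPDE.freeFlight G (Literature.Analysis.FluidPDE.Alexander.freeExitTime G (ε N) z).toReal z; let pairs := fun (N : ℕ) (y : X N) (k : ℕ) => Literature.Analysis.FluidPDE.Alexander.incomingPairs G (ε N) (pre N y k); let D := fun (N : ℕ) (y : X N) (k : ℕ) => Classical.propDecidable (pairs N y k).Nonempty; let stepF := fun (N : ℕ) (y : X N) (W' : Fin (N + 1) → V) (k : ℕ) => @dite (Fin (N + 1) → V) (pairs N y k).Nonempty (D N y k) (fun h => fun i => (Literature.Analysis.FluidPDE.collidePair G h.some.1 h.some.2 (fun j => ((pre N y k j).1, W' j)) i).2) (fun _ => W'); let colls := fun (N : ℕ) (y : X N) (Δ : ℝ) => Literature.Analysis.FluidPDE.Alexander.collisionCount G (ε N) y Δ; let MN := fun (N : ℕ) (y : X N) (n : ℕ) (W : Fin (N + 1) → V) => (List.range n).foldl (stepF N y) W; let bc := fun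 (N : ℕ) (y : X N) (n : ℕ) (i k : Fin (N + 1)) (a : Fin 3) => MN N y n (Pi.single k (EuclideanSpace.single a (1 : ℝ))) i; let bm := fun (N : ℕ) (y : X N) (n : ℕ) (i k : Fin (N + 1)) => ∑ a : Fin 3, ‖bc N y n i k a‖ ^ 2; let nrm := fun (N : ℕ) (y : X N) (k : ℕ) => @dite V (pairs N y k).Nonempty (D N y k) (fun h => G.sepVec (pre N y k h.some.1).1 (pre N y k h.some.2).1) (fun _ => 0); let un := fun (N : ℕ) (y : X N) (k : ℕ) => ‖nrm N y k‖⁻¹ • nrm N y k; let bs := fun (N : ℕ) (y : X N) (n : ℕ) (i k : Fin (N + 1)) (ω : V) => ∑ a : Fin 3, inner ℝ ω (bc N y n i k a) ^ 2; let sf := fun (N : ℕ) (y : X N) (n : ℕ) (i k : Fin (N + 1)) (ω : V) => bs N y n i k ω / bm N y n i k; let sls := fun (N : ℕ) (y : X N) (Δ : ℝ) (S r : ℕ) => colls N y ((r : ℝ) * Δ / (S : ℝ)); let hop := fun (N : ℕ) (y : X N) (src : Fin (N + 1)) (n : ℕ) (i' i : Fin (N + 1)) => @dite ℝ (pairs N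 y n).Nonempty (D N y n) (fun h => let p := h.some.1; let q := h.some.2; let f := fun (j : Fin (N + 1)) => sf N y n j src (un N y n); if i' = p then (if i = p then 1 - f p else if i = q then f p else 0) else if i' = q then (if i = q then 1 - f q else if i = p then f q else 0) else if i = i' then 1 else 0) (fun _ => if i = i' then 1 else 0); let apart := fun (N : ℕ) (y : X N) (src : Fin (N + 1)) (Δ : ℝ) (S r t : ℕ) => @Nat.rec (fun _ => Fin (N + 1) → Fin (N + 1) → ℝ) (fun i j => if i = j then 0 else bm N y (sls N y Δ S r) i src / 3 * (bm N y (sls N y Δ S r) j src / 3)) (fun t ih => fun i j => if i = j then 0 else ∑ i', ∑ j', ih i' j' * (hop N y src (sls N y Δ S r + t) i' i * hop N y src (sls N y Δ S r + t) j' j)) t; let dAt := fun (N : ℕ) (y : X N) (src : Fin (N + 1)) (Δ : ℝ) (S r t : ℕ) => let len := sls N y Δ S r - sls N y Δ S (r - 1); let n := sls N y Δ S (r - 1) + (len + t); ∑ i, ∑ i', ∑ j', apart N y src Δ S (r - 1) (len + t) i' j' * (hop N y src n i' i * hop N y src n j' i); let dFr := fun (N : ℕ) (y : X N) (Δ : ℝ)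 (S : ℕ) => ((N + 1 : ℕ) : ℝ)⁻¹ * ∑ src, ∑ r ∈ Finset.Ico 1 S, ∑ t ∈ Finset.range (sls N y Δ S (r + 1) - sls N y Δ S r), dAt N y src Δ S r t; ∀ Φ : (N : ℕ) → Literature.Analysis.FluidPDE.HardSphereFlow G (ε N) (N + 1), ∀ Δ : ℕ → ℝ, (∀ N, 0 < Δ N) → Tendsto Δ atTop (𝓝 0) → Tendsto (fun N : ℕ => Δ N * ((N + 1 : ℕ) : ℝ) ^ ((1 : ℝ) / 3)) atTop atTop → ∀ t : ℝ, 0 < t → ∀ S : ℕ, 2 ≤ S → ∀ e : ℝ, 0 < e → ∀ᶠ N : ℕ in atTop, ∫⁻ z, ENNReal.ofReal (dFr N ((Φ N).flow (t - Δ N) z) (Δ N) S) ∂(Literature.MathematicalPhysics.KineticTheory.localGibbsLaw σ a₀ u₀ θ₀ N (Φ N)) ≤ ENNReal.ofReal e) ↔ DelayedRemergeRare := by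
  unfold DelayedRemergeRare DelayedRemergeRareAt
  rw [← delayedRemFrRec_eq]
  exact Iff.rfl

end Promotion

end

end Summit.AtomisticToContinuum.HydrodynamicLimit.Theorems.DiffuseBackwardInfluenceShare
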